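import Summits.KontsevichZagierPeriods.KontsevichZagierPeriods.Theses.TorsionLogs
import Summits.KontsevichZagierPeriods.KontsevichZagierPeriods.Theorems.IsogenyCertificatesLemniscateTwoIsogeny
import Literature.NumberTheory.Transcendental.KZLogCalculusProofs
import Literature.NumberTheory.Transcendental.SemialgebraicLineDeriv

/-!
# `OneThirdPeriod` (stmt-KontsevichZagierPeriods-13811, route TorsionLogs)

Closing file. On `E : y² = x³ + 1` (`E(ℝ) ≅ ℝ/ωℤ` connected, `ω = 2∫_{−1}^∞ dx/√(x³+1)`) the arc
`−1 < x < 0`, `y > 0` is the interval `(ω/3, ω/2)` of `u = ∫_x^∞ dt/√(t³+1)` (end points: the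
3-torsion flex `(0,1)` at `u = ω/3`, the 2-torsion point `(−1,0)` at `u = ω/2`), so
`3∫_{−1}^0 dx/√(x³+1) = ∫_{−1}^∞ dx/√(x³+1)` (classically `B(1/3,1/2) = B(1/3,1/6)/2`). Here this
torsion relation is DERIVED inside the Kontsevich–Zagier calculus (`KZ.Equivalent`), with no
transcendence input, along the RATIONAL `x`-coordinate of the doubling map `[2]`,
`Φ(x) = x([2]P) = (x⁴ − 8x)/(4(x³ + 1))`, `Φ′(x) = (x⁶ + 20x³ − 8)/(4(x³ + 1)²)`, which maps the arc
`(−1, 0)` (`(ω/3, ω/2)`) decreasingly onto `(0, ∞)` (`(2ω/3, ω)`) with `[2]^*(dx/y) = 2·dx/y`: the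
polynomial identity `(x⁶ + 20x³ − 8)² = (x⁴ − 8x)³ + 64(x³ + 1)³` gives the rule-(2) Jacobian
identity `2/√(x³+1) = |Φ′(x)|/√(Φ(x)³+1)` on `(−1, 0)`. Chain of moves for
`r = [(−1,0), 3/√(x³+1)]`, `r' = [(−1,∞), 1/√(x³+1)]` (integrands prescribed on the domains):
rule (1a) twice (`[r'] = [r'|(−1,0)] + [r'|{0 ≤ x}]`, `[r'|{0 ≤ x}] = [r'|{x = 0}] + [r'|(0,∞)]`, the
point being a null relation), rule (1b) once (`[r] = [r'|(−1,0)] + [d]`, `d = [(−1,0), 2·r'.integrand]`),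
rule (2) once (`[d] − [r'|(0,∞)]` along `Φ`). (The item text reaches the same relation via translation
by the flex, an algebraic two-valued change of variables; `[2]` is `x`-rational, so every domain here is
cut out by `ℚ`-polynomial inequalities in `x`.) The `ℝ¹` plumbing is reused from
`HermiteRigidityGenusTwoCycleTransferPushforwardDimOne`, `IsogenyCertificatesLemniscateTwoIsogeny` and
`XMapPeriodTransfer.Negative.ValueEqLoadBearing` (`x³ + 1 > 0 ↔ x > −1`).
`OneThirdPeriod_proof` concludes the route declaration by name.

References: M. Kontsevich, D. Zagier, *Periods* (2001), §1.2 rules (1), (2); J. H. Silverman,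
*The Arithmetic of Elliptic Curves* (2009), III.2.3 (duplication formula), III.5.
-/

noncomputable section

open Set MeasureTheory MvPolynomial
open Literature.NumberTheory.Transcendental Literature.ModelTheory.ExponentialFields
open Summit.KontsevichZagierPeriods.HermiteRigidity.GenusTwoCycleTransfer
  (det_smul_id_fin_one hasFDerivAt_fin_one)
open Summit.KontsevichZagierPeriods.IsogenyCertificates.LemniscateTwoIsogeny
  (isSemialgebraic_egg const_apply_zero_eq)
open Summit.KontsevichZagierPeriods.IsogenyCertificates.XMapPeriodTransferValue (cube_add_one_pos_iff)

namespace Summit.KontsevichZagierPeriods.TorsionLogs.OneThirdPeriod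

/-! ### Real algebra of the doubling `x`-map `Φ(x) = (x⁴ − 8x)/(4(x³ + 1))` -/

/-- On `(−1, 0)` the numerator `x⁶ + 20x³ − 8` of `Φ′` is negative. [folklore] -/
theorem num_deriv_neg {x : ℝ} (h1 : -1 < x) (h2 : x < 0) : x ^ 6 + 20 * x ^ 3 - 8 < 0 := by
  have hx3 : x ^ 3 < 0 := Odd.pow_neg (by decide) h2
  have h3 := (cube_add_one_pos_iff _).2 h1
  nlinarith [mul_pos h3 (neg_pos.mpr hx3)]

/-- `Φ > 0` on `(−1, 0)` (numerator `x⁴ − 8x > 0`, denominator `4(x³ + 1) > 0`). [folklore] -/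
theorem phi_pos {x : ℝ} (h1 : -1 < x) (h2 : x < 0) :
    0 < (x ^ 4 - 8 * x) / (4 * (x ^ 3 + 1)) :=
  div_pos (by nlinarith [pow_nonneg (sq_nonneg x) 2]) (mul_pos four_pos ((cube_add_one_pos_iff _).2 h1))

/-- **The duplication identity** `(x⁶ + 20x³ − 8)² = (x⁴ − 8x)³ + 64(x³ + 1)³`, i.e.
`y([2]P)² = Φ(x)³ + 1` with `Φ′ = 2·y([2]P)/y(P)` (`[2]^*(dx/y) = 2·dx/y`). [cite: SilvermanAEC2009, III.2.3] -/
theorem duplication_identity (x : ℝ) :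
    (x ^ 6 + 20 * x ^ 3 - 8) ^ 2 = (x ^ 4 - 8 * x) ^ 3 + 64 * (x ^ 3 + 1) ^ 3 := by
  ring

/-- `Φ(x)³ + 1 = ((−(x⁶ + 20x³ − 8))/(8(x³ + 1)√(x³ + 1)))²` for `x > −1`. [cite: SilvermanAEC2009, III.2.3] -/
theorem phi_cube_add_one {x : ℝ} (h1 : -1 < x) :
    ((x ^ 4 - 8 * x) / (4 * (x ^ 3 + 1))) ^ 3 + 1 =
      (-(x ^ 6 + 20 * x ^ 3 - 8) / (8 * (x ^ 3 + 1) * Real.sqrt (x ^ 3 + 1))) ^ 2 := by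
  have h3 := (cube_add_one_pos_iff _).2 h1
  have hs2 : Real.sqrt (x ^ 3 + 1) ^ 2 = x ^ 3 + 1 := Real.sq_sqrt h3.le
  have h3' : (x ^ 3 + 1) ≠ 0 := h3.ne'
  rw [div_pow, div_pow, mul_pow, mul_pow, hs2, neg_pow_two, duplication_identity]
  field_simp
  ring

/-- **The rule-2 integrand identity** `2/√(x³ + 1) = (1/√(Φ(x)³ + 1))·|Φ′(x)|` on `(−1, 0)`.
[cite: KontsevichZagier2001, §1.2 rule (2)] -/
theorem jacobian_identity {x : ℝ} (h1 : -1 < x) (h2 : x < 0) :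
    2 * (1 / Real.sqrt (x ^ 3 + 1)) =
      1 / Real.sqrt (((x ^ 4 - 8 * x) / (4 * (x ^ 3 + 1))) ^ 3 + 1) *
        |(x ^ 6 + 20 * x ^ 3 - 8) / (4 * (x ^ 3 + 1) ^ 2)| := by
  have h3 := (cube_add_one_pos_iff _).2 h1
  have hN : x ^ 6 + 20 * x ^ 3 - 8 < 0 := num_deriv_neg h1 h2
  have hN' : 0 < -(x ^ 6 + 20 * x ^ 3 - 8) := neg_pos.mpr hN
  have hN0' : -(x ^ 6 + 20 * x ^ 3 - 8) ≠ 0 := hN'.ne'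
  rw [phi_cube_add_one h1]
  set s := Real.sqrt (x ^ 3 + 1) with hs_def
  have hs : 0 < s := Real.sqrt_pos.mpr h3
  have hs0 : s ≠ 0 := hs.ne'
  have hs2 : x ^ 3 + 1 = s ^ 2 := (Real.sq_sqrt h3.le).symm
  rw [hs2]
  have hq : 0 < -(x ^ 6 + 20 * x ^ 3 - 8) / (8 * s ^ 2 * s) := by positivity
  rw [Real.sqrt_sq hq.le, abs_div, abs_of_neg hN,
    abs_of_pos (by positivity : (0:ℝ) < 4 * (s ^ 2) ^ 2), one_div_div, div_mul_div_comm,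
    eq_div_iff (mul_ne_zero hN0' (by positivity))]
  have e : 2 * (1 / s) * (-(x ^ 6 + 20 * x ^ 3 - 8) * (4 * (s ^ 2) ^ 2)) =
      2 * (-(x ^ 6 + 20 * x ^ 3 - 8) * (4 * (s ^ 2) ^ 2)) / s := by ring
  rw [e, div_eq_iff hs0]
  ring

/-- `Φ` is injective on `(−1, 0)`: `(Φ a − Φ b)·4(a³+1)(b³+1) = (a − b)·K` with
`K = (a³+1)(b³+1) + 9ab(a+b) − 9 < 0` there. [folklore] -/
theorem phi_injective {a b : ℝ} (ha1 : -1 < a) (ha2 : a < 0) (hb1 : -1 < b) (hb2 : b < 0)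
    (h : (a ^ 4 - 8 * a) / (4 * (a ^ 3 + 1)) = (b ^ 4 - 8 * b) / (4 * (b ^ 3 + 1))) : a = b := by
  have hA := (cube_add_one_pos_iff _).2 ha1
  have hB := (cube_add_one_pos_iff _).2 hb1
  rw [div_eq_div_iff (mul_pos four_pos hA).ne' (mul_pos four_pos hB).ne'] at h
  have key : (a - b) * ((a ^ 3 + 1) * (b ^ 3 + 1) + 9 * (a * b * (a + b)) - 9) = 0 := by
    linear_combination (1 / 4 : ℝ) * h
  have ha3 : a ^ 3 < 0 := Odd.pow_neg (by decide) ha2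
  have hb3 : b ^ 3 < 0 := Odd.pow_neg (by decide) hb2
  have hP : (a ^ 3 + 1) * (b ^ 3 + 1) < 1 := by
    have h1 : (a ^ 3 + 1) * (b ^ 3 + 1) < 1 * (b ^ 3 + 1) :=
      mul_lt_mul_of_pos_right (by linarith) hB
    linarith
  have hQ : a * b * (a + b) < 0 := mul_neg_of_pos_of_neg (mul_pos_of_neg_of_neg ha2 hb2) (by linarith)
  have hK : (a ^ 3 + 1) * (b ^ 3 + 1) + 9 * (a * b * (a + b)) - 9 ≠ 0 := by
    apply ne_of_lt
    linarith
  rcases mul_eq_zero.mp key with h0 | h0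
  · linarith
  · exact absurd h0 hK

/-- `Φ` has derivative `(x⁶ + 20x³ − 8)/(4(x³ + 1)²)` wherever `x³ + 1 ≠ 0`. [folklore] -/
theorem hasDerivAt_phi {x : ℝ} (hx : x ^ 3 + 1 ≠ 0) :
    HasDerivAt (fun y : ℝ => (y ^ 4 - 8 * y) / (4 * (y ^ 3 + 1)))
      ((x ^ 6 + 20 * x ^ 3 - 8) / (4 * (x ^ 3 + 1) ^ 2)) x := by
  have hnum : HasDerivAt (fun y : ℝ => y ^ 4 - 8 * y) (4 * x ^ 3 - 8) x := by
    have h := (hasDerivAt_pow 4 x).fun_sub (hasDerivAt_const_mul (8 : ℝ))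
    exact h.congr_deriv (by norm_num)
  have hden : HasDerivAt (fun y : ℝ => 4 * (y ^ 3 + 1)) (4 * (3 * x ^ 2)) x := by
    have h := ((hasDerivAt_pow 3 x).add_const (1 : ℝ)).const_mul (4 : ℝ)
    exact h.congr_deriv (by norm_num)
  have h4 : 4 * (x ^ 3 + 1) ≠ 0 := mul_ne_zero four_ne_zero hx
  refine (hnum.fun_div hden h4).congr_deriv ?_
  rw [div_eq_div_iff (pow_ne_zero 2 h4) (mul_ne_zero four_ne_zero (pow_ne_zero 2 hx))]
  ring

/-- **Surjectivity**: every `c > 0` is `Φ x` for some `x ∈ (−1, 0)` (intermediate value theorem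
between a point near `−1`, where `Φ → +∞`, and a point near `0`, where `Φ → 0`). [folklore] -/
theorem exists_phi_eq {c : ℝ} (hc : 0 < c) :
    ∃ x : ℝ, -1 < x ∧ x < 0 ∧ (x ^ 4 - 8 * x) / (4 * (x ^ 3 + 1)) = c := by
  set Φ : ℝ → ℝ := fun y => (y ^ 4 - 8 * y) / (4 * (y ^ 3 + 1)) with hΦ
  -- the left end point `a = −1 + ε`
  set ε : ℝ := min (1 / 2) (1 / (6 * c)) with hε
  have hε0 : 0 < ε := lt_min (by norm_num) (by positivity)
  have hε1 : ε ≤ 1 / 2 := min_le_left _ _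
  have hε2 : ε ≤ 1 / (6 * c) := min_le_right _ _
  set a : ℝ := -1 + ε with ha
  have ha1 : -1 < a := by linarith
  have ha2 : a ≤ -1 / 2 := by linarith
  have ha3 : a ^ 3 + 1 ≤ 3 * ε := by
    have : a ^ 3 + 1 = 3 * ε - 3 * ε ^ 2 + ε ^ 3 := by rw [ha]; ring
    rw [this]
    nlinarith [mul_nonpos_of_nonneg_of_nonpos (sq_nonneg ε) (by linarith : ε - 3 ≤ 0)]
  have hcε : c * ε ≤ 1 / 6 := by
    calc c * ε ≤ c * (1 / (6 * c)) := mul_le_mul_of_nonneg_left hε2 hc.le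
      _ = 1 / 6 := by field_simp
  have hfa : c < Φ a := by
    have hA := (cube_add_one_pos_iff _).2 ha1
    show c < (a ^ 4 - 8 * a) / (4 * (a ^ 3 + 1))
    rw [lt_div_iff₀ (by positivity)]
    have h4 : 0 ≤ a ^ 4 := by positivity
    nlinarith [mul_le_mul_of_nonneg_left ha3 hc.le]
  -- the right end point `b = −δ`
  set δ : ℝ := min (1 / 2) (c / 3) with hδ
  have hδ0 : 0 < δ := lt_min (by norm_num) (by positivity)
  have hδ1 : δ ≤ 1 / 2 := min_le_left _ _
  have hδ2 : δ ≤ c / 3 := min_le_right _ _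
  set b : ℝ := -δ with hb
  have hb2 : b < 0 := by linarith
  have hb1 : -1 < b := by linarith
  have hab : a ≤ b := by linarith
  have hfb : Φ b < c := by
    have hB := (cube_add_one_pos_iff _).2 hb1
    show (b ^ 4 - 8 * b) / (4 * (b ^ 3 + 1)) < c
    rw [div_lt_iff₀ (by positivity), hb]
    have hδ3 : δ ^ 3 ≤ 1 / 8 := by
      have := pow_le_pow_left₀ hδ0.le hδ1 3
      linarith [show ((1:ℝ) / 2) ^ 3 = 1 / 8 by norm_num]
    have hδ4 : δ ^ 4 ≤ δ / 8 := by nlinarith [mul_le_mul_of_nonneg_left hδ3 hδ0.le]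
    have h1 : c * δ ^ 3 ≤ c * (1 / 8) := mul_le_mul_of_nonneg_left hδ3 hc.le
    nlinarith
  -- intermediate value theorem on `[a, b] ⊆ (−1, 0)`
  have hcont : ContinuousOn Φ (Icc a b) := fun x hx =>
    (hasDerivAt_phi ((cube_add_one_pos_iff _).2 (by linarith [hx.1])).ne').continuousAt.continuousWithinAt
  obtain ⟨x, hx, hxc⟩ := intermediate_value_Icc' hab hcont ⟨hfb.le, hfa.le⟩
  exact ⟨x, by linarith [hx.1], by linarith [hx.2], hxc⟩

/-! ### The `x`-map on `ℝ¹` -/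

/-- `p ↦ Φ(p 0) = ((p 0)⁴ − 8 p 0)/(4((p 0)³ + 1))` is a `ℚ`-semialgebraic function on any
`ℚ`-semialgebraic set inside `{−1 < p 0}` (a quotient of `ℚ`-polynomials, pole-free there).
[cite: BochnakCosteRoy1998, §2.2] -/
theorem phi_semialgebraic {T : Set (Fin 1 → ℝ)} (hT : IsSemialgebraic ℚ T)
    (h1 : ∀ p ∈ T, -1 < p 0) :
    IsSemialgebraicFunOn ℚ T (fun p => ((p 0) ^ 4 - 8 * p 0) / (4 * ((p 0) ^ 3 + 1))) := by
  have h := isSemialgebraicFunOn_aeval_div_aeval hT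
    (X 0 ^ 4 - 8 * X 0 : MvPolynomial (Fin 1) ℚ) (4 * (X 0 ^ 3 + 1))
    (fun p hp => by
      simp only [map_mul, map_add, map_pow, map_one, aeval_X, map_ofNat]
      exact (mul_pos four_pos ((cube_add_one_pos_iff _).2 (h1 p hp))).ne')
  refine h.congr fun p _ => ?_
  simp only [map_mul, map_sub, map_add, map_pow, map_one, aeval_X, map_ofNat]

/-! ### One rule-2 move along `Φ` on the arc `(−1, 0)` -/

/-- **Rule 2 along the doubling `x`-map.** For `d = [A, 2/√(x³+1)]` on the arc `A = {−1 < p 0 < 0}`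
and `t = [{−1 < p 0 ∧ 0 < p 0}, 1/√(x³+1)]` (integrands prescribed on the domains),
`[d] − [t] ∈ KZ.changeOfVariablesRel`, witnessed by `Φ : p ↦ (Φ(p 0))`, `Φ' p = Φ′(p 0) • id` (`Φ` is
`ℚ`-semialgebraic and injective on `A`, `Φ(A) = (0, ∞)`, `det Φ' = Φ′`). [cite: KontsevichZagier2001, §1.2 rule (2)] -/
theorem arc_cov (d t : KZ.IntegralRep 1)
    (hdd : d.domain = {p : Fin 1 → ℝ | -1 < p 0 ∧ p 0 < 0})
    (hdi : ∀ p ∈ d.domain, d.integrand p = 2 * (1 / Real.sqrt ((p 0) ^ 3 + 1)))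
    (htd : t.domain = {p : Fin 1 → ℝ | -1 < p 0 ∧ 0 < p 0})
    (hti : ∀ p ∈ t.domain, t.integrand p = 1 / Real.sqrt ((p 0) ^ 3 + 1)) :
    KZ.of d - KZ.of t ∈ KZ.changeOfVariablesRel := by
  set Φ : (Fin 1 → ℝ) → (Fin 1 → ℝ) :=
    fun p _ => ((p 0) ^ 4 - 8 * p 0) / (4 * ((p 0) ^ 3 + 1)) with hΦ_def
  set Φ' : (Fin 1 → ℝ) → ((Fin 1 → ℝ) →L[ℝ] (Fin 1 → ℝ)) := fun p =>
    (((p 0) ^ 6 + 20 * (p 0) ^ 3 - 8) / (4 * ((p 0) ^ 3 + 1) ^ 2)) •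
      ContinuousLinearMap.id ℝ (Fin 1 → ℝ) with hΦ'_def
  have hmem : ∀ p ∈ d.domain, -1 < p 0 ∧ p 0 < 0 := fun p hp => by rwa [hdd] at hp
  -- Φ is a semialgebraic map, with derivative Φ' within the arc, injective on the arc
  have hΦsa : IsSemialgebraicMapOn ℚ d.domain Φ :=
    IsSemialgebraicMapOn.of_forall d.isSemialgebraic_domain fun _ =>
      phi_semialgebraic d.isSemialgebraic_domain fun p hp => (hmem p hp).1
  have hderiv : ∀ p ∈ d.domain, HasFDerivWithinAt Φ (Φ' p) d.domain p := fun p hp =>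
    (hasFDerivAt_fin_one (fun y : ℝ => (y ^ 4 - 8 * y) / (4 * (y ^ 3 + 1))) _ p
      (hasDerivAt_phi ((cube_add_one_pos_iff _).2 (hmem p hp).1).ne')).hasFDerivWithinAt
  have hinj : InjOn Φ d.domain := by
    intro p hp q hq h
    have h' : ((p 0) ^ 4 - 8 * p 0) / (4 * ((p 0) ^ 3 + 1)) =
        ((q 0) ^ 4 - 8 * q 0) / (4 * ((q 0) ^ 3 + 1)) := congrFun h 0
    have hpq : p 0 = q 0 :=
      phi_injective (hmem p hp).1 (hmem p hp).2 (hmem q hq).1 (hmem q hq).2 h'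
    rw [← const_apply_zero_eq p, ← const_apply_zero_eq q, hpq]
  have hdet : ∀ p, (Φ' p).det = ((p 0) ^ 6 + 20 * (p 0) ^ 3 - 8) / (4 * ((p 0) ^ 3 + 1) ^ 2) :=
    fun p => det_smul_id_fin_one _
  -- the image of the arc is `(0, ∞)`
  have himg : t.domain = Φ '' d.domain := by
    rw [htd, hdd]
    ext q
    simp only [mem_image, mem_setOf_eq]
    constructor
    · intro hq
      obtain ⟨x, hx1, hx2, hx⟩ := exists_phi_eq hq.2
      refine ⟨fun _ => x, ⟨hx1, hx2⟩, ?_⟩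
      rw [← const_apply_zero_eq q]
      funext i
      exact hx
    · rintro ⟨p, ⟨hp1, hp2⟩, rfl⟩
      have h0 : 0 < ((p 0) ^ 4 - 8 * p 0) / (4 * ((p 0) ^ 3 + 1)) := phi_pos hp1 hp2
      refine ⟨?_, h0⟩
      show -1 < ((p 0) ^ 4 - 8 * p 0) / (4 * ((p 0) ^ 3 + 1))
      linarith
  -- the Jacobian identity on the arc
  have hjac : ∀ p ∈ d.domain, d.integrand p = t.integrand (Φ p) * |(Φ' p).det| := by
    intro p hp
    have hΦp : Φ p ∈ t.domain := himg ▸ mem_image_of_mem Φ hp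
    rw [hdi p hp, hti _ hΦp, hdet p]
    exact jacobian_identity (hmem p hp).1 (hmem p hp).2
  exact ⟨1, d, t, Φ, Φ', hΦsa, hderiv, hinj, himg, hjac, rfl⟩

/-! ### The chain of moves -/

/-- **One third of the real period as moves** (explicit form): for `r = [(−1,0), 3/√(x³+1)]` and
`r' = [(−1,∞), 1/√(x³+1)]`, `KZ.Equivalent r r'` — two rule-(1a) splits at `x = 0`, the null point,
one rule-(1b) move `3/√ = 1/√ + 2/√`, one rule-(2) move along `Φ`. [cite: KontsevichZagier2001, §1.2 rules (1), (2)] -/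
theorem transfer (r r' : KZ.IntegralRep 1)
    (hd : r.domain = {x | x 0 ∈ Set.Ioo (-1:ℝ) 0})
    (hi : EqOn r.integrand (fun x => 3 / Real.sqrt (x 0 ^ 3 + 1)) r.domain)
    (hd' : r'.domain = {x | -1 < x 0})
    (hi' : EqOn r'.integrand (fun x => 1 / Real.sqrt (x 0 ^ 3 + 1)) r'.domain) :
    KZ.Equivalent r r' := by
  -- the pieces of `(−1, ∞) ⊆ ℝ¹`
  set A : Set (Fin 1 → ℝ) := {p | -1 < p 0 ∧ p 0 < 0} with hA_def
  set R : Set (Fin 1 → ℝ) := {p | -1 < p 0 ∧ 0 ≤ p 0} with hR_def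
  set Z : Set (Fin 1 → ℝ) := {p | -1 < p 0 ∧ p 0 = 0} with hZ_def
  set C : Set (Fin 1 → ℝ) := {p | -1 < p 0 ∧ 0 < p 0} with hC_def
  have hS : IsSemialgebraic ℚ {p : Fin 1 → ℝ | -1 < p 0} := hd' ▸ r'.isSemialgebraic_domain
  have hA : IsSemialgebraic ℚ A := isSemialgebraic_egg
  -- `{0 ≤ x}`, `{x = 0}`, `{0 < x}` are cut out by the `ℚ`-polynomial `X 0`
  have h0le : IsSemialgebraic ℚ {p : Fin 1 → ℝ | 0 ≤ p 0} := by
    simpa using isSemialgebraic_setOf_eval_nonneg (k := ℚ) (R := ℝ) (X 0 : MvPolynomial (Fin 1) ℚ)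
  have h0eq : IsSemialgebraic ℚ {p : Fin 1 → ℝ | p 0 = 0} := by
    simpa using isSemialgebraic_setOf_eval_eq_zero (k := ℚ) (R := ℝ) (X 0 : MvPolynomial (Fin 1) ℚ)
  have h0lt : IsSemialgebraic ℚ {p : Fin 1 → ℝ | 0 < p 0} := by
    simpa using isSemialgebraic_setOf_eval_pos (k := ℚ) (R := ℝ) (X 0 : MvPolynomial (Fin 1) ℚ)
  have hR : IsSemialgebraic ℚ R := hS.inter h0le
  have hZ : IsSemialgebraic ℚ Z := hS.inter h0eq
  have hC : IsSemialgebraic ℚ C := hS.inter h0lt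
  have hdA : r.domain = A := by rw [hd]; rfl
  have hAsub : A ⊆ r'.domain := fun p hp => by rw [hd']; exact hp.1
  have hRsub : R ⊆ r'.domain := fun p hp => by rw [hd']; exact hp.1
  have hZsub : Z ⊆ r'.domain := fun p hp => by rw [hd']; exact hp.1
  have hCsub : C ⊆ r'.domain := fun p hp => by rw [hd']; exact hp.1
  set rA := r'.restrict A hA hAsub with hrA
  set rR := r'.restrict R hR hRsub with hrR
  set rZ := r'.restrict Z hZ hZsub with hrZ
  set rC := r'.restrict C hC hCsub with hrC
  -- the representation `d = [A, 2·r'.integrand]`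
  have hd_sa : IsSemialgebraicFunOn ℚ A (fun p => 2 * r'.integrand p) :=
    (isSemialgebraicFunOn_const_ofNat hA 2).fun_mul (r'.isSemialgebraicFunOn_integrand.mono hAsub hA)
  have hd_int : IntegrableOn (fun p => 2 * r'.integrand p) A :=
    (r'.integrableOn.mono_set hAsub).const_mul 2
  set d : KZ.IntegralRep 1 := ⟨A, fun p => 2 * r'.integrand p, hA, hd_sa, hd_int⟩ with hd_def
  -- the point `{x = 0}` is null
  have hZnull : volume Z = 0 :=
    measure_mono_null (fun p hp => hp.2) (KZ.volume_setOf_last_eq_zero (n := 0) 0)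
  -- move 1 (rule 1a): [(−1,∞)] = [(−1,0)] + [{0 ≤ x}]
  have m1 : KZ.of r' - KZ.of rA - KZ.of rR ∈ KZ.domainAddRel := by
    refine ⟨1, r', rA, rR, ?_, ?_, fun _ _ => rfl, fun _ _ => rfl, rfl⟩
    · show r'.domain = A ∪ R
      rw [hd']
      ext p
      simp only [mem_setOf_eq, mem_union, hA_def, hR_def]
      constructor
      · intro h
        rcases lt_or_ge (p 0) 0 with h' | h'
        · exact Or.inl ⟨h, h'⟩
        · exact Or.inr ⟨h, h'⟩
      · rintro (h | h)
        · exact h.1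
        · exact h.1
    · show volume (A ∩ R) = 0
      have he : A ∩ R = ∅ := by
        refine eq_empty_of_forall_notMem fun p hp => ?_
        have h1 : p 0 < 0 := hp.1.2
        have h2 : 0 ≤ p 0 := hp.2.2
        exact (not_lt.mpr h2) h1
      rw [he, measure_empty]
  -- move 2 (rule 1a): [{0 ≤ x}] = [{x = 0}] + [(0,∞)]
  have m2 : KZ.of rR - KZ.of rZ - KZ.of rC ∈ KZ.domainAddRel := by
    refine ⟨1, rR, rZ, rC, ?_, ?_, fun _ _ => rfl, fun _ _ => rfl, rfl⟩
    · show R = Z ∪ C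
      ext p
      simp only [mem_setOf_eq, mem_union, hR_def, hZ_def, hC_def]
      constructor
      · intro h
        rcases h.2.lt_or_eq with h' | h'
        · exact Or.inr ⟨h.1, h'⟩
        · exact Or.inl ⟨h.1, h'.symm⟩
      · rintro (h | h)
        · exact ⟨h.1, h.2.ge⟩
        · exact ⟨h.1, h.2.le⟩
    · show volume (Z ∩ C) = 0
      exact measure_mono_null inter_subset_left hZnull
  -- move 3: the point representation is a relation (null domain)
  have m3 : KZ.of rZ ∈ KZ.relations := KZ.of_mem_relations_of_volume_eq_zero rZ hZnull
  -- move 4 (rule 1b): [r] = [(−1,0), 1/√] + [(−1,0), 2/√]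
  have m4 : KZ.of r - KZ.of rA - KZ.of d ∈ KZ.integrandAddRel := by
    refine ⟨1, r, rA, d, hdA.symm, hdA.symm, fun p hp => ?_, rfl⟩
    have hpA : p ∈ A := hdA ▸ hp
    have h1 := hi hp
    have h2 := hi' (hAsub hpA)
    show r.integrand p = r'.integrand p + 2 * r'.integrand p
    rw [h1, h2]
    ring
  -- move 5 (rule 2 along Φ): [(−1,0), 2/√] ∼ [(0,∞), 1/√]
  have m5 : KZ.of d - KZ.of rC ∈ KZ.changeOfVariablesRel :=
    arc_cov d rC rfl (fun p hp => by
        show 2 * r'.integrand p = 2 * (1 / Real.sqrt (p 0 ^ 3 + 1))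
        rw [hi' (hAsub hp)])
      rfl (fun p hp => hi' (hCsub hp))
  -- compose
  have h1 := KZ.domainAddRel_subset_relations m1
  have h2 := KZ.domainAddRel_subset_relations m2
  have h4 := KZ.integrandAddRel_subset_relations m4
  have h5 := KZ.changeOfVariablesRel_subset_relations m5
  show KZ.of r - KZ.of r' ∈ KZ.relations
  have : KZ.of r - KZ.of r' = (KZ.of r - KZ.of rA - KZ.of d) + (KZ.of d - KZ.of rC) -
      (KZ.of r' - KZ.of rA - KZ.of rR) - (KZ.of rR - KZ.of rZ - KZ.of rC) - KZ.of rZ := by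
    abel
  rw [this]
  exact KZ.relations.sub_mem (KZ.relations.sub_mem (KZ.relations.sub_mem
    (KZ.relations.add_mem h4 h5) h1) h2) m3

/-- **`OneThirdPeriod`** (stmt-KontsevichZagierPeriods-13811): on `y² = x³ + 1`, any representations
`r = [(−1,0), 3/√(x³+1)]`, `r' = [(−1,∞), 1/√(x³+1)]` (integrands prescribed on the domains only) are
`KZ.Equivalent`: the torsion relation `3∫_{−1}^0 dx/√(x³+1) = ∫_{−1}^∞ dx/√(x³+1)` (`u_Q = ω/3`) is
derivable by Kontsevich–Zagier's rules (1), (2) along `x∘[2]`. [cite: KontsevichZagier2001, §1.2 rules (1), (2)] -/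
theorem OneThirdPeriod_proof :
    Summit.KontsevichZagierPeriods.KontsevichZagierPeriods.Theses.TorsionLogs.OneThirdPeriod := by
  unfold Summit.KontsevichZagierPeriods.KontsevichZagierPeriods.Theses.TorsionLogs.OneThirdPeriod
  intro r r' hd hi hd' hi'
  exact transfer r r' hd hi hd' hi'

end Summit.KontsevichZagierPeriods.TorsionLogs.OneThirdPeriod

end
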